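/-
Cell pub-hodgecm2 (COR-CM = stage 2 of the Hodge ladder), seat p2 (binder prover 2/8), gen 22
(prover-pub-hodgecm2-p2-g22-0), 2026-08-21.  Count-neutral own lane PERL-WEIL-LINE, file H: the W-a + W-b glue
(`CorCM/PerLHodgeFourCore.lean`, p297646) composed with seat b25's adapter
`PairFlipSexticFourCore.exists_frame_normalForm` (`CorCM/PairFlipSexticFourCoreAnyTypes.lean`) — the frame hypotheses
are DISCHARGED.  Theorems only; `PerL` is consumed BY NAME (`Universe.PerL`), never restated.
T5: the only hypothesis binder of Literature/conjecture type is `hP : U_rec.PerL` (resp. NONE in the field-local form,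
whose period hypothesis `hK` is an ordinary ∀∃-statement about ONE field) — PerL(U_rec) is the cell's standing
hypothesis; no contradiction derived.  HONEST FRAMING: HC_CM is NOT proved; `PerLFace`/B01 are not used.
-/
import Summits.HodgeConjecture.CorCM.PerLHodgeFourCore
import Summits.HodgeConjecture.CorCM.PairFlipSexticFourCoreAnyTypes
import HarnessLib

/-!
# `PerL` ⟹ the Hodge conjecture for every product of powers of ANY four pairwise inequivalent CM threefolds of a
# sextic CM field with Galois closure of degree 24 or 48 — frame-free

`PerLFourCore.hodgeConjectureFor_biproduct_comp_of_perL_rec` (`CorCM/PerLHodgeFourCore.lean`) concludes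
`HodgeConjectureFor (⨁_j A₄ (κ j))` from `PerL(U_rec)` and b25's FRAME DATA (`e`, `he_conj`, `he_gal`, `hΦ`); b25's
adapter `PairFlipSexticFourCore.exists_frame_normalForm` (`CorCM/PairFlipSexticFourCoreAnyTypes.lean`) produces those
frame data for ANY realisations `A₄ b ⊨ (K; Φ₄ b)` of four pairwise different, pairwise non-conjugate CM types of a
sextic CM field `K` with a normal closure of degree `24` or `48` (re-typing the SAME abelian varieties by conjugate
types / twisted actions where needed).  Composing:

* **`hodgeConjectureFor_biproduct_comp_of_perLAt_rec_of_pairwise_ne`** — FIELD-LOCAL: if the conclusion of `PerL`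
  holds AT the sextic field `K` (for every frame, every `ι₁` over it and every PerL quadruple there is a hermitian
  space with a non-vanishing period on `U_rec` — the hypothesis `hK`, i.e. `U_rec.PerL` specialised to `(K, L, j)`),
  then `HodgeConjectureFor (⨁_j A₄ (κ j))` for every `κ` and ANY four realisations of pairwise inequivalent types;
  `…_of_avDominatedBy_…` for everything such a product dominates;
* **`hodgeConjectureFor_biproduct_comp_of_perL_rec_of_pairwise_ne`**, **`hodgeConjectureFor_of_avDominatedBy_of_perL_rec_of_pairwise_ne`** —
  the same from the universal statement `U_rec.PerL`.

One sentence (honest): «In the kernel, stage 1's statement PerL on the model universe of record — indeed already its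
instance at one sextic CM field K with Galois closure of degree 24 or 48 — implies the Hodge conjecture for every
abelian variety dominated by a product of powers of any four pairwise non-isogenous-type CM abelian threefolds with
CM by K.»  A NAMED CLASS, conditional on PerL; NOT HC_CM.
References: PerL v5 Thm 4.4; rfwf v3 Prop 2.2 / §4.2; Pohlmann 1968 Thm 1; Gao–Ullmo 2025 Thm 3.1; Shimura 1998 §6.1,
§8.4; Dodson 1984 §5.1; `hodge-director/B01-SIZE.md` §4 T2 (W-a + W-b).
-/

noncomputable section

open CategoryTheory CategoryTheory.Limits NumberField
open Literature.AlgebraicGeometry Literature.AlgebraicGeometry.Motives Literature.AlgebraicGeometry.HodgeTheory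
open Literature.AlgebraicGeometry.ComplexMultiplication (IsCMTypeRealisation)
open Literature.NumberTheory.Automorphic
open Literature.NumberTheory.ComplexMultiplication.CMTypeOps (bar)
open Summit.HodgeConjecture.CorCM.PairFlipSexticFourCore (exists_frame_normalForm)

namespace Summit.HodgeConjecture.CorCM.PerLFourCore

variable {K : CMField} {A₄ : Fin 4 → AbelianVariety ℂ} {Φ₄ : Fin 4 → CMType (K : Type)}
  {ι₄ : ∀ b : Fin 4, 𝓞 (K : Type) →+* End (A₄ b)}
  {θ₄ : ∀ b : Fin 4, (K : Type) →+* Module.End ℂ (complexBetti (A₄ b).X 1)}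

/-- **PerL AT ONE FIELD ⟹ the Hodge conjecture for every product of powers of any four pairwise inequivalent CM
threefolds of that field.**  `K` sextic CM, `j : K → L` a normal closure of degree `24` or `48`; `hK` = the conclusion of
`Universe.PerL` at `(K, L, j)` on the model universe of record (for every frame `φ`, `ι₁` over `φ 0` and PerL quadruple
`t`, some hermitian space carries a non-vanishing period); `A₄ b ⊨ (K; Φ₄ b)` ANY realisations of four pairwise
different, pairwise non-conjugate CM types.  Then `HodgeConjectureFor (⨁_j A₄ (κ j))` for every slot map `κ`.
Route: b25's `exists_frame_normalForm` (frame `e`, normalised types on the same varieties), the model frame's PerL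
quadruple (`isFrame_frameOfModel`, `isPerLTypes_frameOfModel`), an `ι₁` over its first embedding
(`PerLTypes.exists_ringHom_comp_eq`), `hK` there, and `hodgeConjectureFor_biproduct_comp_of_periodNV_rec`.  NOT HC_CM.
[cite: Pohlmann1968, Thm 1] [cite: GaoUllmo2025, Thm 3.1] [cite: Shimura1998, §6.1 Corollary of Theorem 2 and Remark, printed p. 41] -/
theorem hodgeConjectureFor_biproduct_comp_of_perLAt_rec_of_pairwise_ne (L : CMField)
    (j : (K : Type) →+* (L : Type)) (hN : IsNormalClosure ℚ (K : Type) (L : Type))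
    (h6 : Module.finrank ℚ K = 6) (hL : Module.finrank ℚ L = 24 ∨ Module.finrank ℚ L = 48)
    (hK : ∀ (φ : Fin 3 → ((K : Type) →+* ℂ)), IsFrame φ → ∀ (ι₁ : (L : Type) →+* ℂ), ι₁.comp j = φ 0 →
      ∀ (t : Fin 4 → CMType (K : Type)), IsPerLTypes φ t → ∃ V : HermSpace3 L ι₁,
        (Model.picardCMUniverse exists_isReal_hodgeModel_holds hodgePQ_independent_of_hodgeModel_holds
          BallQuotient.ballQuotientUniformised_holds cmAbelianVarietyRealised_holds).PeriodNV ι₁ V K t (φ 0))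
    (hA : ∀ b, IsCMTypeRealisation (Φ₄ b) (A₄ b) (ι₄ b) (θ₄ b))
    (hne : ∀ a b : Fin 4, a ≠ b → ∃ s, ¬ (s ∈ (Φ₄ a).1 ↔ s ∈ (Φ₄ b).1))
    (hnc : ∀ a b : Fin 4, a ≠ b → ∃ s, ¬ (s ∈ (Φ₄ a).1 ↔ s ∉ (Φ₄ b).1))
    {N : ℕ} (κ : Fin N → Fin 4) :
    HodgeConjectureFor (⨁ fun j => A₄ (κ j)).dim (⨁ fun j => A₄ (κ j)).X := by
  haveI := hN
  obtain ⟨e, Φ', ι', θ', hA', he_conj, he_gal, hΦ'⟩ := exists_frame_normalForm h6 (L : Type) hL hA hne hnc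
  obtain ⟨ι₁, hι⟩ := PerLTypes.exists_ringHom_comp_eq K L j (e.symm (((![2, 0, 1] : Fin 3 → ZMod 3) 0), true))
  obtain ⟨V, hV⟩ := hK _ (isFrame_frameOfModel he_conj) ι₁ hι _ (isPerLTypes_frameOfModel hΦ')
  exact hodgeConjectureFor_biproduct_comp_of_periodNV_rec hA' he_conj he_gal hΦ' ⟨L, ι₁, V, _, hV⟩ κ

/-- **PerL AT ONE FIELD ⟹ the Hodge conjecture for every abelian variety dominated by such a product of powers**
(every abelian variety isogenous to a product of powers of the four threefolds, their abelian subvarieties and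
quotients). NOT HC_CM. [cite: Milne2020HodgeClassesAV, Theorem 1] [cite: MumfordAV1970, §19] -/
theorem hodgeConjectureFor_of_avDominatedBy_of_perLAt_rec_of_pairwise_ne (L : CMField)
    (j : (K : Type) →+* (L : Type)) (hN : IsNormalClosure ℚ (K : Type) (L : Type))
    (h6 : Module.finrank ℚ K = 6) (hL : Module.finrank ℚ L = 24 ∨ Module.finrank ℚ L = 48)
    (hK : ∀ (φ : Fin 3 → ((K : Type) →+* ℂ)), IsFrame φ → ∀ (ι₁ : (L : Type) →+* ℂ), ι₁.comp j = φ 0 →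
      ∀ (t : Fin 4 → CMType (K : Type)), IsPerLTypes φ t → ∃ V : HermSpace3 L ι₁,
        (Model.picardCMUniverse exists_isReal_hodgeModel_holds hodgePQ_independent_of_hodgeModel_holds
          BallQuotient.ballQuotientUniformised_holds cmAbelianVarietyRealised_holds).PeriodNV ι₁ V K t (φ 0))
    (hA : ∀ b, IsCMTypeRealisation (Φ₄ b) (A₄ b) (ι₄ b) (θ₄ b))
    (hne : ∀ a b : Fin 4, a ≠ b → ∃ s, ¬ (s ∈ (Φ₄ a).1 ↔ s ∈ (Φ₄ b).1))
    (hnc : ∀ a b : Fin 4, a ≠ b → ∃ s, ¬ (s ∈ (Φ₄ a).1 ↔ s ∉ (Φ₄ b).1))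
    {N : ℕ} (κ : Fin N → Fin 4) {B : AbelianVariety ℂ} (hB : Domination.AVDominatedBy B (⨁ fun j => A₄ (κ j))) :
    HodgeConjectureFor B.dim B.X :=
  Domination.hodgeConjectureFor_of_avDominatedBy
    (hodgeConjectureFor_biproduct_comp_of_perLAt_rec_of_pairwise_ne L j hN h6 hL hK hA hne hnc κ) hB

/-- **`PerL(U_rec)` ⟹ the Hodge conjecture for every product of powers of ANY four pairwise inequivalent CM threefolds
of a sextic CM field with a normal closure of degree `24` or `48`** — frame-free form of
`hodgeConjectureFor_biproduct_comp_of_perL_rec` (the frame data of b25's transfer theorem are produced by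
`exists_frame_normalForm`).  Single hypothesis beyond the field/realisation data: `U_rec.PerL` (stage 1's statement,
consumed by name).  NOT HC_CM. [cite: Pohlmann1968, Thm 1] [cite: GaoUllmo2025, Thm 3.1]
[cite: Shimura1998, §6.1 Corollary of Theorem 2 and Remark, printed p. 41] -/
theorem hodgeConjectureFor_biproduct_comp_of_perL_rec_of_pairwise_ne
    (hP : (Model.picardCMUniverse exists_isReal_hodgeModel_holds hodgePQ_independent_of_hodgeModel_holds
      BallQuotient.ballQuotientUniformised_holds cmAbelianVarietyRealised_holds).PerL)
    (L : CMField) (j : (K : Type) →+* (L : Type)) (hN : IsNormalClosure ℚ (K : Type) (L : Type))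
    (h6 : Module.finrank ℚ K = 6) (hL : Module.finrank ℚ L = 24 ∨ Module.finrank ℚ L = 48)
    (hA : ∀ b, IsCMTypeRealisation (Φ₄ b) (A₄ b) (ι₄ b) (θ₄ b))
    (hne : ∀ a b : Fin 4, a ≠ b → ∃ s, ¬ (s ∈ (Φ₄ a).1 ↔ s ∈ (Φ₄ b).1))
    (hnc : ∀ a b : Fin 4, a ≠ b → ∃ s, ¬ (s ∈ (Φ₄ a).1 ↔ s ∉ (Φ₄ b).1))
    {N : ℕ} (κ : Fin N → Fin 4) :
    HodgeConjectureFor (⨁ fun j => A₄ (κ j)).dim (⨁ fun j => A₄ (κ j)).X :=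
  hodgeConjectureFor_biproduct_comp_of_perLAt_rec_of_pairwise_ne L j hN h6 hL (hP K L j hN h6 hL) hA hne hnc κ

/-- **`PerL(U_rec)` ⟹ the Hodge conjecture for every abelian variety dominated by a product of powers of any four
pairwise inequivalent CM threefolds of such a field** — frame-free. NOT HC_CM. [cite: Milne2020HodgeClassesAV, Theorem 1]
[cite: MumfordAV1970, §19] -/
theorem hodgeConjectureFor_of_avDominatedBy_of_perL_rec_of_pairwise_ne
    (hP : (Model.picardCMUniverse exists_isReal_hodgeModel_holds hodgePQ_independent_of_hodgeModel_holds
      BallQuotient.ballQuotientUniformised_holds cmAbelianVarietyRealised_holds).PerL)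
    (L : CMField) (j : (K : Type) →+* (L : Type)) (hN : IsNormalClosure ℚ (K : Type) (L : Type))
    (h6 : Module.finrank ℚ K = 6) (hL : Module.finrank ℚ L = 24 ∨ Module.finrank ℚ L = 48)
    (hA : ∀ b, IsCMTypeRealisation (Φ₄ b) (A₄ b) (ι₄ b) (θ₄ b))
    (hne : ∀ a b : Fin 4, a ≠ b → ∃ s, ¬ (s ∈ (Φ₄ a).1 ↔ s ∈ (Φ₄ b).1))
    (hnc : ∀ a b : Fin 4, a ≠ b → ∃ s, ¬ (s ∈ (Φ₄ a).1 ↔ s ∉ (Φ₄ b).1))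
    {N : ℕ} (κ : Fin N → Fin 4) {B : AbelianVariety ℂ} (hB : Domination.AVDominatedBy B (⨁ fun j => A₄ (κ j))) :
    HodgeConjectureFor B.dim B.X :=
  Domination.hodgeConjectureFor_of_avDominatedBy
    (hodgeConjectureFor_biproduct_comp_of_perL_rec_of_pairwise_ne hP L j hN h6 hL hA hne hnc κ) hB

end Summit.HodgeConjecture.CorCM.PerLFourCore

end
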